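/-
Copyright: the b2b-balaban T⁴-continuum CRUX team, row NE7b OWNER lineage `t4-ne7b-p1` (gen 106). Project licence.
-/
import Summits.QuantumFields.BalabanUV.T4Continuum.Spine.NE7b.CompactFibreCarrier
import Summits.QuantumFields.BalabanUV.T4Continuum.Spine.NE7b.CarrierOnSupport

/-!
# `LocCondStability` BY NAME for the COMPACT-FIBRE (positivity-alone) carrier: `M = (∫F·w·e^{−I}) ∕ (∫G·w·e^{−I})` over a finite near
# fibre inhabits the road's named `Prop` with `b = i⁺ + b_vol`, `e^{b_vol} ≥ ∫F dκ ∕ ∫G dκ` the volume-ratio letter (row NE7b, node U5c;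
# kernel junction — the creation-level companion of `…PerturbedCarrierLCS`)

Cell `pub-balaban`, sub-cell `t4`, spine estimate NE7b (`T4WeightBudget.RelWeightBound`; the cell's OWN estimate — NOT PRINTED in
[Bałaban 1983–89], NOT PROVED).  Crux-route work under `Spine/NE7b/` by the row's OWNER; NOTHING of Bałaban's is named or asserted;
no `T4Continuum/Support` leaf typed; no `def`; zero `sorry`.

WHY.  `…NE7b.CompactFibreCarrier` typed the creation-level mechanism of print ([Balaban1989LargeFieldI] (0.1) p. 175 + Haar on the
region's group-valued variables; the refuter's Q-ne7bref-g68-1 reading (n)): with a finite near fibre `(K, κ)` and NO kept Gaussian,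
positivity `I ≥ 0` on the numerator's support and smallness `I ≤ i⁺` on the window give the conditional moment the price
`e^{i⁺}·(∫F dκ ∕ ∫G dκ)`.  `…NE7b.PerturbedCarrierLCS` is the junction BY NAME for the Gaussian-fibre (𝐑-level) carrier; THIS FILE is
the same junction for the compact-fibre (creation-level) carrier: per pattern prefix `g` of a level `j < K` and background `y`, fibre
spaces `Kf j g`, `Yf j g` with measures `κ j g`, `ν j g` (the pinned region's bond group with Haar; the rest), data `F, G, w, I`
depending on `(j, g, y)`, and ON THE SUPPORT OF THE TERM (`eterm j g y ≠ 0`) the hypotheses of `compactFibre_moment_le` with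
`y`-UNIFORM letters `i⁺ j g` and `b_vol j g` (`∫F dκ ∕ ∫G dκ ≤ e^{b_vol}` — for a Haar probability and a product window,
`b_vol = Σ_bonds(−log κ_b(W_b))`, `…CompactFibreCarrier.log_volumeRatio_le`) ⟹ `LocCondStability T S K μ ρ₀ M (i⁺ + b_vol)`.

WHAT IS PROVED ([folklore]; plumbing over `compactFibre_moment_le` and the gen-105 `locCondStability_of_carrier_le_on_support`):
`compactCarrier_nonneg`, `compactCarrier_le` (`0 ≤ M ≤ e^{i⁺ + b_vol}` per background), **`locCondStability_of_compactCarrier_on_support`**.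

NOT HERE (honest): that Bałaban's creation-level one-step kernels ARE of this form ((A3)); the letters `i⁺`, `b_vol` by value (the
hierarchy's windows, [Balaban1989LargeFieldI] p. 178 (1.3)–(1.9); SU(2) Haar small balls — pub-balaban-gaps ne6 g11's
`CompactFibreWindowSU2`); the denominator's positivity where the instance identifies `M` with the kernel's ratio (Lean's `x ∕ 0 = 0`
makes a vanishing denominator vacuously stable — chair leaf-05 g136's κ-1 on `PerturbedCarrierLCS`, the same sentence applies here);
anything of Bałaban's.  NE7b NOT PRINTED ∕ NOT PROVED; spine PROVED 0∕9; rung (B)+1 on a FINITE torus — NOT infinite volume, NOT the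
mass gap, NOT Clay.
HONEST DEPENDENCY: continuum YM on T⁴ ⇐ BetaPertH ∧ nine spine estimates (0/9 proved); BetaPertH ⇐ (D1) ∧ (D4) ∧ CAP+tail.
-/

set_option autoImplicit false

open MeasureTheory Real Finset
open Summit.QuantumFields.BalabanUV.T4Continuum.B16HistoryIndexedRepr Summit.QuantumFields.BalabanUV.T4Continuum.B16HistoryReprChain
open Summit.QuantumFields.BalabanUV.T4Continuum.NE7b.PrefixExtraction Summit.QuantumFields.BalabanUV.T4Continuum.NE7b.LocalConditionalStability
open Summit.QuantumFields.BalabanUV.T4Continuum.NE7b.CarrierOnSupport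
open Summit.QuantumFields.BalabanUV.T4Continuum.NE7b.CompactFibreCarrier

namespace Summit.QuantumFields.BalabanUV.T4Continuum.NE7b.CompactFibreLCS

/-! ## §1 One background: the compact-fibre carrier is non-negative and at most `e^{i⁺ + b_vol}` -/

section OneBackground

variable {Kf Yf : Type*} [MeasurableSpace Kf] [MeasurableSpace Yf] (κ : Measure Kf) (ν : Measure Yf) [SFinite κ] [SFinite ν]

omit [SFinite κ] [SFinite ν] in
/-- The compact-fibre conditional moment is non-negative (non-negative data; Lean's `x ∕ 0 = 0`). [folklore] -/
theorem compactCarrier_nonneg (F G : Kf → ℝ) (w : Yf → ℝ) (I : Kf × Yf → ℝ)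
    (hF0 : ∀ x, 0 ≤ F x) (hG0 : ∀ x, 0 ≤ G x) (hw0 : ∀ y, 0 ≤ w y) :
    0 ≤ (∫ z, F z.1 * w z.2 * exp (-I z) ∂(κ.prod ν)) / ∫ z, G z.1 * w z.2 * exp (-I z) ∂(κ.prod ν) :=
  div_nonneg (integral_nonneg fun _ => mul_nonneg (mul_nonneg (hF0 _) (hw0 _)) (exp_pos _).le)
    (integral_nonneg fun _ => mul_nonneg (mul_nonneg (hG0 _) (hw0 _)) (exp_pos _).le)

/-- **THE COMPACT-FIBRE CARRIER OF ONE BACKGROUND IS AT MOST `e^{i⁺ + b_vol}`** under the hypotheses of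
`…CompactFibreCarrier.compactFibre_moment_le` and the volume-ratio letter `∫F dκ ∕ ∫G dκ ≤ e^{b_vol}`. [folklore] -/
theorem compactCarrier_le (F G : Kf → ℝ) (w : Yf → ℝ) (I : Kf × Yf → ℝ) {ip bvol : ℝ}
    (hF0 : ∀ x, 0 ≤ F x) (hG0 : ∀ x, 0 ≤ G x) (hw0 : ∀ y, 0 ≤ w y)
    (hIpos : ∀ z : Kf × Yf, F z.1 ≠ 0 → w z.2 ≠ 0 → 0 ≤ I z)
    (hIsmall : ∀ z : Kf × Yf, G z.1 ≠ 0 → w z.2 ≠ 0 → I z ≤ ip)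
    (hGpos : 0 < ∫ x, G x ∂κ) (hfrac : (∫ x, F x ∂κ) / (∫ x, G x ∂κ) ≤ exp bvol)
    (hA : Integrable (fun z : Kf × Yf => F z.1 * w z.2) (κ.prod ν))
    (hB' : Integrable (fun z : Kf × Yf => G z.1 * w z.2 * exp (-I z)) (κ.prod ν)) :
    (∫ z, F z.1 * w z.2 * exp (-I z) ∂(κ.prod ν)) / (∫ z, G z.1 * w z.2 * exp (-I z) ∂(κ.prod ν)) ≤ exp (ip + bvol) := by
  have hD : 0 ≤ ∫ z, G z.1 * w z.2 * exp (-I z) ∂(κ.prod ν) :=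
    integral_nonneg fun _ => mul_nonneg (mul_nonneg (hG0 _) (hw0 _)) (exp_pos _).le
  refine Summit.QuantumFields.BalabanUV.T4Continuum.NE7b.LocalPerturbationSandwich.div_le_of_le_mul (exp_pos _).le hD ?_
  calc ∫ z, F z.1 * w z.2 * exp (-I z) ∂(κ.prod ν)
      ≤ (exp ip * ((∫ x, F x ∂κ) / ∫ x, G x ∂κ)) * ∫ z, G z.1 * w z.2 * exp (-I z) ∂(κ.prod ν) :=
        compactFibre_moment_le κ ν F G w I hF0 hG0 hw0 hIpos hIsmall hGpos hA hB'
    _ ≤ (exp ip * exp bvol) * ∫ z, G z.1 * w z.2 * exp (-I z) ∂(κ.prod ν) :=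
        mul_le_mul_of_nonneg_right (mul_le_mul_of_nonneg_left hfrac (exp_pos _).le) hD
    _ = exp (ip + bvol) * ∫ z, G z.1 * w z.2 * exp (-I z) ∂(κ.prod ν) := by rw [exp_add]

end OneBackground

/-! ## §2 The junction: `LocCondStability` by name for the compact-fibre carrier, from data displayed on the support -/

section Junction

variable {P : Type} [DecidableEq P] {C : ℕ → Type} {𝒢 : (j : ℕ) → GoodClass (C j)}

/-- **LCS FOR A BACKGROUND-DEPENDENT COMPACT-FIBRE CARRIER, ON THE SUPPORT.**  At every pattern prefix `g` of a level `j < K` and every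
background `y` let `M j g y` be the compact-fibre conditional moment of the data at `(j, g, y)` — near fibre `Kf j g` with measure
`κ j g` (the pinned region's group variables with Haar), far space `Yf j g` with `ν j g`, numerator factor `F`, window `G`, far weight
`w`, interaction `I`, all depending on `(j, g, y)` —; suppose `M j g` is a.e.-strongly measurable and ON THE SUPPORT OF THE TERM the
hypotheses of `…CompactFibreCarrier.compactFibre_moment_le` hold with the `y`-UNIFORM letters `i⁺ j g` (smallness of the interaction on
the window; positivity elsewhere) and `b_vol j g` (`∫F dκ ∕ ∫G dκ ≤ e^{b_vol}`).  Then `LocCondStability T S K μ ρ₀ M (i⁺ + b_vol)`,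
integrability conjunct included. [folklore] -/
theorem locCondStability_of_compactCarrier_on_support (T : Tower P C 𝒢) (Spat : (j : ℕ) → (Fin j → P) → Finset P)
    (K : ℕ) [∀ j, MeasurableSpace (C j)] (μ : (j : ℕ) → Measure (C j)) (ρ₀ : C 0 → ℝ)
    (M : (j : ℕ) → (Fin j → P) → C j → ℝ)
    (Kf Yf : (j : ℕ) → (Fin j → P) → Type) [∀ j g, MeasurableSpace (Kf j g)] [∀ j g, MeasurableSpace (Yf j g)]
    (κ : (j : ℕ) → (g : Fin j → P) → Measure (Kf j g)) (ν : (j : ℕ) → (g : Fin j → P) → Measure (Yf j g))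
    [∀ j g, SFinite (κ j g)] [∀ j g, SFinite (ν j g)]
    (F G : (j : ℕ) → (g : Fin j → P) → C j → Kf j g → ℝ) (w : (j : ℕ) → (g : Fin j → P) → C j → Yf j g → ℝ)
    (I : (j : ℕ) → (g : Fin j → P) → C j → Kf j g × Yf j g → ℝ) (ip bvol : (j : ℕ) → (Fin j → P) → ℝ)
    (hρ : (𝒢 0).Gd ρ₀) (h0 : ∀ x, 0 ≤ ρ₀ x)
    (hM : ∀ j g, j < K → g ∈ admS T Spat j → ∀ y, M j g y =
      (∫ z, F j g y z.1 * w j g y z.2 * exp (-I j g y z) ∂((κ j g).prod (ν j g))) /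
        ∫ z, G j g y z.1 * w j g y z.2 * exp (-I j g y z) ∂((κ j g).prod (ν j g)))
    (hMm : ∀ j g, j < K → g ∈ admS T Spat j → AEStronglyMeasurable (M j g) (μ j))
    (hF0 : ∀ j g, j < K → g ∈ admS T Spat j → ∀ y x, 0 ≤ F j g y x)
    (hG0 : ∀ j g, j < K → g ∈ admS T Spat j → ∀ y x, 0 ≤ G j g y x)
    (hw0 : ∀ j g, j < K → g ∈ admS T Spat j → ∀ y x, 0 ≤ w j g y x)
    (hIpos : ∀ j g, j < K → g ∈ admS T Spat j → ∀ y, T.eterm ρ₀ j g y ≠ 0 → ∀ z : Kf j g × Yf j g,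
      F j g y z.1 ≠ 0 → w j g y z.2 ≠ 0 → 0 ≤ I j g y z)
    (hIsmall : ∀ j g, j < K → g ∈ admS T Spat j → ∀ y, T.eterm ρ₀ j g y ≠ 0 → ∀ z : Kf j g × Yf j g,
      G j g y z.1 ≠ 0 → w j g y z.2 ≠ 0 → I j g y z ≤ ip j g)
    (hGpos : ∀ j g, j < K → g ∈ admS T Spat j → ∀ y, T.eterm ρ₀ j g y ≠ 0 → 0 < ∫ x, G j g y x ∂κ j g)
    (hfrac : ∀ j g, j < K → g ∈ admS T Spat j → ∀ y, T.eterm ρ₀ j g y ≠ 0 →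
      (∫ x, F j g y x ∂κ j g) / (∫ x, G j g y x ∂κ j g) ≤ exp (bvol j g))
    (hA : ∀ j g, j < K → g ∈ admS T Spat j → ∀ y, T.eterm ρ₀ j g y ≠ 0 →
      Integrable (fun z : Kf j g × Yf j g => F j g y z.1 * w j g y z.2) ((κ j g).prod (ν j g)))
    (hB' : ∀ j g, j < K → g ∈ admS T Spat j → ∀ y, T.eterm ρ₀ j g y ≠ 0 →
      Integrable (fun z : Kf j g × Yf j g => G j g y z.1 * w j g y z.2 * exp (-I j g y z)) ((κ j g).prod (ν j g)))
    (hint : ∀ j g, j < K → g ∈ admS T Spat j → Integrable (T.eterm ρ₀ j g) (μ j)) :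
    LocCondStability T Spat K μ ρ₀ M (fun j g => ip j g + bvol j g) := by
  refine locCondStability_of_carrier_le_on_support T Spat K μ ρ₀ M _ hρ h0 hMm (fun j g hj hg y => ?_)
    (fun j g hj hg y hy => ?_) hint
  · rw [hM j g hj hg y]
    exact compactCarrier_nonneg _ _ _ _ _ _ (hF0 j g hj hg y) (hG0 j g hj hg y) (hw0 j g hj hg y)
  · rw [hM j g hj hg y]
    exact compactCarrier_le _ _ _ _ _ _ (hF0 j g hj hg y) (hG0 j g hj hg y) (hw0 j g hj hg y) (hIpos j g hj hg y hy)
      (hIsmall j g hj hg y hy) (hGpos j g hj hg y hy) (hfrac j g hj hg y hy) (hA j g hj hg y hy) (hB' j g hj hg y hy)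

end Junction

end Summit.QuantumFields.BalabanUV.T4Continuum.NE7b.CompactFibreLCS
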